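import Literature.NumberTheory.Transcendental.KZCalculus
import Literature.NumberTheory.Transcendental.KZRelationsLE
import HarnessLib

/-!
# Invariants of sub-calculi of the Kontsevich–Zagier moves, and integer-scaling bookkeeping

Kontsevich–Zagier [KZ 2001, §1.2] generate `KZ.relations` by four move sets (1a) domain additivity,
(1b) integrand additivity, (2) change of variables, (3) Newton–Leibniz (`KZCalculus.lean`). Several
routes of the summit `KontsevichZagierPeriods` ask which moves a given relation NEEDS (route
ScissorsAvatars: the Newton–Leibniz-free "scissors" sub-calculus; route FurushoPentagon: Hoffman's
relation "must cross the corner"). This file supplies the two elementary additive invariants that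
separate the obvious sub-calculi, and the integrand-additivity bookkeeping `[σ, k·f] ~ k•[σ, f]`
used to clear integer denominators (routes FurushoPentagon `IntegerDivision`, ScissorsAvatars
`DivisibilityScissors`, CoactionDevissage `TorsionFree` all consume it):

* `KZ.coeffSum : FormalRep →+ ℤ` (every generator `↦ 1`) kills the subgroup generated by moves
  (2) + (3), which are differences of TWO generators (`KZ.closure_cov_nl_le_ker_coeffSum`); the
  additivity moves have coefficient sum `−1`.
* `KZ.restrictedEval A : FormalRep →+ ℝ` (integrate each generator over `domain ∩ A n` only, for a
  family of measurable windows `A n ⊆ ℝⁿ`) kills the subgroup generated by the additivity moves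
  (1a) + (1b) (`KZ.closure_add_le_ker_restrictedEval`); it is not preserved by (2) or (3).
* `KZ.IntegralRep.of_constMul_nat_sub_nsmul_mem`: `[σ, k f] − k•[σ, f]` lies in the subgroup
  generated by integrand additivity alone (`[σ,(j+1)f] − [σ, j f] − [σ, f] ∈ integrandAddRel`,
  induction on `j`).

All proofs are elementary (soundness-style computations with Mathlib's set integral); nothing here
is specific to multiple zeta values.

## References

* M. Kontsevich, D. Zagier, *Periods*, in: Mathematics Unlimited — 2001 and Beyond, Springer
  (2001), §1.2 (the rules).
-/

noncomputable section

open MeasureTheory Set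

namespace Literature.NumberTheory.Transcendental

namespace KZ

variable {n : ℕ}

/-! ### The coefficient sum: an invariant of moves (2) + (3) -/

/-- The coefficient sum of a formal combination of integral representations: the additive map
`FormalRep →+ ℤ` sending every generator `[r]` to `1`. [cite: KontsevichZagier2001, §1.2] -/
def coeffSum : FormalRep →+ ℤ := FreeAbelianGroup.lift fun _ => (1 : ℤ)

/-- The coefficient sum of a generator is `1`. [cite: KontsevichZagier2001, §1.2] -/
@[simp] theorem coeffSum_of (r : IntegralRep n) : coeffSum (of r) = 1 :=
  FreeAbelianGroup.lift_apply_of _ _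

/-- A change-of-variables move `[r] − [r']` has coefficient sum `0`. [cite: KontsevichZagier2001, §1.2] -/
theorem coeffSum_eq_zero_of_mem_changeOfVariablesRel {c : FormalRep} (hc : c ∈ changeOfVariablesRel) :
    coeffSum c = 0 := by
  obtain ⟨n, r, r', Φ, Φ', -, -, -, -, -, rfl⟩ := hc
  simp

/-- A Newton–Leibniz move `[r] − [r']` has coefficient sum `0`. [cite: KontsevichZagier2001, §1.2] -/
theorem coeffSum_eq_zero_of_mem_newtonLeibnizRel {c : FormalRep} (hc : c ∈ newtonLeibnizRel) :
    coeffSum c = 0 := by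
  obtain ⟨n, r, r', a, b, F, -, -, -, -, -, -, -, -, rfl⟩ := hc
  simp

/-- **Moves (2) + (3) preserve the coefficient sum**: the subgroup generated by change-of-variables
and Newton–Leibniz moves lies in the kernel of `coeffSum`. Consequently a combination with non-zero
coefficient sum (e.g. any 3-term identity `[r] − [r₁] − [r₂]`) needs an additivity move.
[cite: KontsevichZagier2001, §1.2] -/
theorem closure_cov_nl_le_ker_coeffSum :
    AddSubgroup.closure (changeOfVariablesRel ∪ newtonLeibnizRel) ≤ coeffSum.ker := by
  refine (AddSubgroup.closure_le _).mpr ?_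
  rintro c (hc | hc)
  · exact coeffSum_eq_zero_of_mem_changeOfVariablesRel hc
  · exact coeffSum_eq_zero_of_mem_newtonLeibnizRel hc

/-- The additivity moves are NOT in the kernel: a domain-additivity instance `[r] − [r₁] − [r₂]`
has coefficient sum `−1`. [cite: KontsevichZagier2001, §1.2] -/
theorem coeffSum_eq_neg_one_of_mem_domainAddRel {c : FormalRep} (hc : c ∈ domainAddRel) :
    coeffSum c = -1 := by
  obtain ⟨n, r, r₁, r₂, -, -, -, -, rfl⟩ := hc
  simp

/-- An integrand-additivity instance `[r] − [r₁] − [r₂]` has coefficient sum `−1`.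
[cite: KontsevichZagier2001, §1.2] -/
theorem coeffSum_eq_neg_one_of_mem_integrandAddRel {c : FormalRep} (hc : c ∈ integrandAddRel) :
    coeffSum c = -1 := by
  obtain ⟨n, r, r₁, r₂, -, -, -, rfl⟩ := hc
  simp

/-! ### Restricted evaluation: an invariant of moves (1a) + (1b) -/

/-- Restricted evaluation: integrate each generator only over `domain ∩ A n`, for a fixed family of
windows `A n ⊆ ℝⁿ` (one per dimension). For `A n = univ` this is `KZ.eval`.
[cite: KontsevichZagier2001, §1.2] -/
def restrictedEval (A : (n : ℕ) → Set (Fin n → ℝ)) : FormalRep →+ ℝ :=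
  FreeAbelianGroup.lift fun p => ∫ x in p.2.domain ∩ A p.1, p.2.integrand x

/-- Restricted evaluation of a generator. [cite: KontsevichZagier2001, §1.2] -/
@[simp] theorem restrictedEval_of (A : (n : ℕ) → Set (Fin n → ℝ)) (r : IntegralRep n) :
    restrictedEval A (of r) = ∫ x in r.domain ∩ A n, r.integrand x :=
  FreeAbelianGroup.lift_apply_of _ _

/-- Domain additivity preserves restricted evaluation over a measurable window: the localisation
to `A n` of the soundness computation `∫_{σ₁ ∪ σ₂} f = ∫_{σ₁} f + ∫_{σ₂} f` (`σ₁ ∩ σ₂` null).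
[cite: KontsevichZagier2001, §1.2 rule (1)] -/
theorem restrictedEval_eq_zero_of_mem_domainAddRel (A : (n : ℕ) → Set (Fin n → ℝ))
    (hA : ∀ n, MeasurableSet (A n)) {c : FormalRep} (hc : c ∈ domainAddRel) :
    restrictedEval A c = 0 := by
  obtain ⟨n, r, r₁, r₂, hdom, hnull, h₁, h₂, rfl⟩ := hc
  have hm₁ : MeasurableSet r₁.domain := IntegralRep.measurableSet_domain_holds r₁
  have hm₂ : MeasurableSet r₂.domain := IntegralRep.measurableSet_domain_holds r₂
  have hsub : (r₁.domain ∩ A n) ∩ (r₂.domain ∩ A n) ⊆ r₁.domain ∩ r₂.domain :=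
    fun x hx => ⟨hx.1.1, hx.2.1⟩
  have hae : AEDisjoint volume (r₁.domain ∩ A n) (r₂.domain ∩ A n) := measure_mono_null hsub hnull
  have hi₁ : IntegrableOn r.integrand (r₁.domain ∩ A n) :=
    r.integrableOn.mono_set (inter_subset_left.trans (hdom ▸ subset_union_left))
  have hi₂ : IntegrableOn r.integrand (r₂.domain ∩ A n) :=
    r.integrableOn.mono_set (inter_subset_left.trans (hdom ▸ subset_union_right))
  simp only [map_sub, restrictedEval_of]
  rw [sub_sub, sub_eq_zero, hdom, Set.union_inter_distrib_right,
    setIntegral_union₀ hae (hm₂.inter (hA n)).nullMeasurableSet hi₁ hi₂,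
    setIntegral_congr_fun (hm₁.inter (hA n)) (h₁.mono inter_subset_left),
    setIntegral_congr_fun (hm₂.inter (hA n)) (h₂.mono inter_subset_left)]

/-- Integrand additivity preserves restricted evaluation over a measurable window
(`∫_{σ ∩ A} (f₁ + f₂) = ∫_{σ ∩ A} f₁ + ∫_{σ ∩ A} f₂`). [cite: KontsevichZagier2001, §1.2 rule (1)] -/
theorem restrictedEval_eq_zero_of_mem_integrandAddRel (A : (n : ℕ) → Set (Fin n → ℝ))
    (hA : ∀ n, MeasurableSet (A n)) {c : FormalRep} (hc : c ∈ integrandAddRel) :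
    restrictedEval A c = 0 := by
  obtain ⟨n, r, r₁, r₂, h₁, h₂, hadd, rfl⟩ := hc
  have hm : MeasurableSet r.domain := IntegralRep.measurableSet_domain_holds r
  simp only [map_sub, restrictedEval_of]
  rw [sub_sub, sub_eq_zero, setIntegral_congr_fun (hm.inter (hA n)) (hadd.mono inter_subset_left),
    h₁, h₂]
  exact integral_add (r₁.integrableOn.mono_set (h₁ ▸ inter_subset_left))
    (r₂.integrableOn.mono_set (h₂ ▸ inter_subset_left))

/-- **Moves (1a) + (1b) preserve restricted evaluation**: for every family of measurable windows,
the subgroup generated by the two additivity moves lies in the kernel of `restrictedEval A`. Since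
changes of variables and Newton–Leibniz moves do not preserve it, a combination whose restricted
value over some window is non-zero needs a move of type (2) or (3).
[cite: KontsevichZagier2001, §1.2] -/
theorem closure_add_le_ker_restrictedEval (A : (n : ℕ) → Set (Fin n → ℝ))
    (hA : ∀ n, MeasurableSet (A n)) :
    AddSubgroup.closure (domainAddRel ∪ integrandAddRel) ≤ (restrictedEval A).ker := by
  refine (AddSubgroup.closure_le _).mpr ?_
  rintro c (hc | hc)
  · exact restrictedEval_eq_zero_of_mem_domainAddRel A hA hc
  · exact restrictedEval_eq_zero_of_mem_integrandAddRel A hA hc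

/-! ### Integer scaling is integrand additivity -/

namespace IntegralRep

/-- One bookkeeping step: `[σ, (k+1) f] − [σ, k f] − [σ, f]` is an integrand-additivity move.
[cite: KontsevichZagier2001, §1.2 rule (1)] -/
theorem of_constMul_succ_sub_mem_integrandAddRel (r : IntegralRep n) (k : ℕ) :
    of (r.constMul ((k + 1 : ℕ) : ℝ) (isAlgebraic_nat (k + 1))) -
      of (r.constMul (k : ℝ) (isAlgebraic_nat k)) - of r ∈ integrandAddRel :=
  ⟨n, r.constMul ((k + 1 : ℕ) : ℝ) (isAlgebraic_nat (k + 1)), r.constMul (k : ℝ) (isAlgebraic_nat k),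
    r, rfl, rfl,
    fun x _ => by simp only [integrand_constMul, Pi.add_apply]; push_cast; ring, rfl⟩

/-- The zero-scaled representation `[σ, 0·f]` is (the negative of) an integrand-additivity move
`[σ,0f] − [σ,0f] − [σ,0f]`, hence lies in the subgroup generated by (1b).
[cite: KontsevichZagier2001, §1.2 rule (1)] -/
theorem of_constMul_zero_mem_closure_integrandAddRel (r : IntegralRep n) :
    of (r.constMul ((0 : ℕ) : ℝ) (isAlgebraic_nat 0)) ∈ AddSubgroup.closure integrandAddRel := by
  have h0 : of (r.constMul ((0 : ℕ) : ℝ) (isAlgebraic_nat 0)) -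
      of (r.constMul ((0 : ℕ) : ℝ) (isAlgebraic_nat 0)) -
      of (r.constMul ((0 : ℕ) : ℝ) (isAlgebraic_nat 0)) ∈ integrandAddRel :=
    ⟨n, r.constMul ((0 : ℕ) : ℝ) (isAlgebraic_nat 0), r.constMul ((0 : ℕ) : ℝ) (isAlgebraic_nat 0),
      r.constMul ((0 : ℕ) : ℝ) (isAlgebraic_nat 0), rfl, rfl,
      fun x _ => by simp only [integrand_constMul, Pi.add_apply]; push_cast; ring, rfl⟩
  rw [sub_self, zero_sub] at h0
  simpa using (AddSubgroup.closure integrandAddRel).neg_mem (AddSubgroup.subset_closure h0)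

/-- **Integer scaling is integrand additivity**: `[σ, k f] − k•[σ, f]` lies in the subgroup
generated by the integrand-additivity moves alone (induction on `k`). This is the bookkeeping half
of "division by a positive integer is a derived rule": together with a scaling endomorphism
`[σ, f] ↦ [σ, f/k]` preserving a sub-calculus `C ⊇ closure integrandAddRel`, it gives
`k•c ∈ C → c ∈ C`. [cite: KontsevichZagier2001, §1.2 rule (1)] -/
theorem of_constMul_nat_sub_nsmul_mem (r : IntegralRep n) (k : ℕ) :
    of (r.constMul (k : ℝ) (isAlgebraic_nat k)) - k • of r ∈ AddSubgroup.closure integrandAddRel := by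
  induction k with
  | zero => simpa using r.of_constMul_zero_mem_closure_integrandAddRel
  | succ k ih =>
    have : of (r.constMul ((k + 1 : ℕ) : ℝ) (isAlgebraic_nat (k + 1))) - (k + 1) • of r =
        (of (r.constMul ((k + 1 : ℕ) : ℝ) (isAlgebraic_nat (k + 1))) -
          of (r.constMul (k : ℝ) (isAlgebraic_nat k)) - of r) +
        (of (r.constMul (k : ℝ) (isAlgebraic_nat k)) - k • of r) := by
      rw [succ_nsmul]; abel
    rw [this]
    exact AddSubgroup.add_mem _
      (AddSubgroup.subset_closure (r.of_constMul_succ_sub_mem_integrandAddRel k)) ih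

/-- Corollary in `KZ.relations`: `[σ, k f]` and `k•[σ, f]` are congruent modulo the moves.
[cite: KontsevichZagier2001, §1.2 rule (1)] -/
theorem of_constMul_nat_sub_nsmul_mem_relations (r : IntegralRep n) (k : ℕ) :
    of (r.constMul (k : ℝ) (isAlgebraic_nat k)) - k • of r ∈ relations :=
  AddSubgroup.closure_mono (fun _ hc => Or.inl (Or.inl (Or.inr hc)))
    (r.of_constMul_nat_sub_nsmul_mem k)

end IntegralRep

end KZ

end Literature.NumberTheory.Transcendental
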